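import Summits.QuantumFields.YangMills.Theorems.BalabanUVNodesN07SplitClauseOfShearVariation
import Summits.QuantumFields.YangMills.Theorems.BalabanUVNodesN07SplitClauseBoxesCubeDomains
import Summits.QuantumFields.YangMills.Theorems.BalabanUVNodesN07CubeDomainsAdm22
import HarnessLib

/-!
# N07 [B11] (= [15] = [Balaban1985Variational]) Sect. F, road of record R0′, WIDTH-209 row (r2), FILE 11: **THE ς-DOOR AT THE S6 HEAD's FAMILY AND WINDOW** — dag-n07-w4's
# FILE 2 `N07SplitClauseRecordShearAtCubeDomains` (p628904) RE-KEYED on FILE 9's variation-keyed record door (p630500): `D := Node00.cubeDomains (F.P K) a M ρ (K − n)`,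
# `Y := π '' □`, canonical weights and CANONICAL LEVEL BOXES with their three box-membership facts discharged BY NAME (dag-n07-w4 FILE 1 p627154, n07-e 39b), and the
# shear letter block `(u♮, U₁, v_j, a_j, σ, hDσ)` REPLACED by ONE variation letter `ς`; plus the (r1) orientation and the FINE form

Cell `pub-ymgap`, width seat `pub-ymgap-dag-n07-w8` g5, WIDTH-209 N07 row (r2) of road R0′, CLAIM-11 ∕ INTENT-11 (cell bus I.37349; OFFER I.37148 to dag-n07-w4 inverted —
typed by w8 to spare the S6 head the re-key; their FILE 2's proof VERBATIM).  `--kind proof --supports stmt-QuantumFields-27364 --as helper` (K1⁹ per dag-lead KEY MAP v2 ∕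
GATE v1.69); count-neutral; def-free.  [15] = [Balaban1985Variational]; [6] = [Balaban1985RegularSpaces]; [4] = [Balaban1984PropagatorsII]; [I.4] = [Balaban1984PropagatorsI];
[3] = [Balaban1985Averaging].

THE POINT (LOCATED-CRUDE-SHEAR-LETTER, cell bus I.36833; FILE 9's header).  p628904 composes FILE 8's σ-door at the head's objects and therefore displays the binder
`d(M + 4ρ + 3)·L^{(K−n)−j}·(v_j + a_j) ≤ σ ≤ ½` for every `j ≤ K − n` — the «box-sup letter × walk length» supplier of the shear's variation, dischargeable only at the top
`O(log_L(1∕dMδ))` levels with the typed letters (`a_j = 60ℓLR` level-uniform, `v_j ≥ v_k` along dag-n07-w6's (155)-ladder).  THIS FILE is the same composition over FILE 9's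
ς-door: what stays DISPLAYED on the shear side is ONE letter, the variation `dist1 ĝ_j(y) ≤ ς` of the gauge `u♮ = u⁻¹` on the canonical boxes (box form) or
`dist1 (u♮(x)⁻¹·u♮(x′)) ≤ ς` on a fine site set `S` containing the boxes' representatives (fine form) — whose full-height supplier is the data lane's per-fine-bond letters by the
coarsest crossed face (dag-n07-w6 p630963 `N07FineBondByCoarsestFace`) summed along coordinate runs (`N07FinePathCrossingCount`, theirs) through FILE 9 §1's socket.  The S6 head's
(159)-assembly (`N07SplitClauseHeadAtCubeDomains`, p630546) re-keys on this file by swapping one import and one `obtain`.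

WHAT IS PROVED (sorry-free; no definition; axioms standard; proofs = p628904's with the door swapped).
* ★★★ `localGaugeSplitOn_of_gauge152_recordShearVariation_dominated_cubeDomains_box F N` — p628904's ★★★ with `(uL U₁ v av σ hv0 ha0 hσ hDσ hv hav)` ↦
  `(uL {ς} hς0 hς hvar)`, `hvar : ∀ j ≤ K − n, ∀ y ∈ castSite '' [lo_j, hi_j], dist1 ((u♮↾T^{(j)})(castSite lo_j)⁻¹·(u♮↾T^{(j)})(y)) ≤ ς`; conclusion
  `LocalGaugeSplitOn (π '' □) η_{K−n} t (t₁ + (t₂ + t_∂) + t₃) U` for every `t_∂ > 2CB₃·(4ς)`.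
* ★★ `localGaugeSplitOn_of_gauge152_recordShearVariation_neg_cubeDomains_box F N` — the (r1) orientation `λ_j := −log ĝ_j⁻¹`.
* ★★ `localGaugeSplitOn_of_gauge152_recordShearFineVariation_dominated_cubeDomains_box F N` — the FINE form: `{S} (hvarU : ∀ x x′ ∈ S, dist1 (u♮(x)⁻¹·u♮(x′)) ≤ ς)` and
  `hS : ∀ j ≤ K − n, ∀ y ∈ box_j, embIter j y ∈ S` (DISPLAYED — the cube family's margins pin `S :=` the fine collar cube; dag-n07-w4 FILE 1's arithmetic).
HONEST SCOPE.  Count-neutral by-name composition of landed theorems (FILE 9 p630500, dag-n07-w4 p627154, n07-e 39b p600410); nothing of [15]∕[6]∕[4]∕[3] ANALYSIS asserted; the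
displayed binders (`H_V` kernel formula, `ς`, the gauge `u♮`, S3's gauge and (152) letters, the (159)-splitting and its three letters, the HB door's side conditions) are NOT
discharged; `LocalLettersSplitTopStepCore(G∕R)` ∕ `DatumGaugeSplitTopStepCore(G∕R)` ∕ `HalvingStepTop(Core)` ∕ `stub_prop8StepCoP13` NOT discharged; K0⁷ ∕ K1⁹ NOT closed; N07 NOT
discharged; counts unmoved (typed 28∕28 · discharged 5∕27); one finite 𝕋⁴ programme at fixed ε — the route closes the conditional finite-𝕋⁴ rung `BalabanLadder.UV` ONLY; the YM
mass gap (Clay) is NOT proved by any of this; nothing continuum ∕ ℝ⁴ ∕ OS.  No `sorry`, no `def`, no `instance`, no `notation`.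

RELATED IN THE TREE, NOT DUPLICATED (stem check 2026-08-28T11:56Z: `ls …/Theorems | rg -i 'ShearVariationAtCube|VariationAtCubeDomains'` = ∅): dag-n07-w4 `N07SplitClauseRecordShearAtCubeDomains`
(the σ-edition — the short-tower case, valid and NOT restated), FILE 9 `N07SplitClauseOfShearVariation` (the generic-family ς-doors — CONSUMED BY NAME), dag-n07-w4 FILE 1
`N07SplitClauseBoxesCubeDomains` + n07-e `N07CubeDomainsAdm22` (geometry — CONSUMED).

References: [15] (144) p. 300, (150)–(152) p. 301, (157)–(159) pp. 302–303, (161) p. 303, (164)–(165) p. 304, (168) p. 304; [6] (1.131) p. 99, p. 98; [4] (2.1)–(2.4)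
p. 224, (2.35) p. 228, (2.60) p. 234, Cor. 2.8 (2.150)–(2.151) p. 249; [I.4] (1.18)–(1.20) p. 20; [3] (8), (11) p. 19, (85)–(88) p. 31.
-/

set_option autoImplicit false

noncomputable section
open scoped BigOperators Matrix.Norms.L2Operator

namespace Summit.QuantumFields.YangMills.BalabanUVNodes.N07SplitClauseRecordShearVariationAtCubeDomains

open Literature.MathematicalPhysics.QuantumFieldTheory.Balaban1983to89
open Literature.MathematicalPhysics.QuantumFieldTheory.Balaban1983to89.Node00
open Literature.MathematicalPhysics.QuantumFieldTheory.Balaban1983to89.B12RegularSpaces111 (gaugeU expI grad)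
open B15Eq112TorusCover (cover)
open B14DomainGeom (Pt)
open B5Eq118OneStroke (iterBlockOf)
open B8Eq131Cubes (sqLo sqHi box cube)
open B11Eq115Space (levOf)
open B6SectADomainsV1 (Domains)
open B6SectAOperatorsV1 (BondIdx)
open B15DeterminingSets (embIter)
open T4Continuum (T4Family)
open T4AxialGaugeSmallField (castSite)
open B16Sect1Backgrounds (toMS)
open GaugeField (gaugeAct)
open MatrixLog (mlog)
open Summit.QuantumFields.YangMills.Theorems.FlatCubeOpsText (Adm22)
open Summit.QuantumFields.YangMills.Theorems.K0FlatCubeOpsTextP (flatH IsLevWeight)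
open Summit.QuantumFields.YangMills.BalabanUVNodes.N07HalvingStepTopOfLocalLetters (Letters10On)
open Summit.QuantumFields.YangMills.BalabanUVNodes.N07LocalLettersSplitCore (LocalGaugeSplitOn)
open Summit.QuantumFields.YangMills.BalabanUVNodes.N07SplitClauseOfShearVariation (localGaugeSplitOn_of_gauge152_recordShearVariation_dominated_adm22_T4
  dist1_centredShear_le_of_fineVariation)
open Summit.QuantumFields.YangMills.BalabanUVNodes.N07SplitClauseBoxesCubeDomains (levelBoxes_cubeDomains)
open Summit.QuantumFields.YangMills.BalabanUVNodes.N07CubeDomainsAdm22 (adm22_cubeDomains inOm_top_cubeDomains_of_mem_box)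

open scoped Classical in
/-- ★★★ **THE ς-DOOR AT THE HEAD's FAMILY AND WINDOW** (statement in the header): FILE 9's `localGaugeSplitOn_of_gauge152_recordShearVariation_dominated_adm22_T4` at
`D := cubeDomains (F.P K) a M ρ (K − n)`, `Y := π '' box L a M (K − n)`, canonical weights and CANONICAL LEVEL BOXES, with `Adm22`, `IsLevWeight`, «window over `Ω_k`» and the
three box-membership facts DISCHARGED (39b, dag-n07-w4 FILE 1); shear side = the gauge `u♮` and ONE variation letter `0 ≤ ς ≤ ½`, `dist1 ĝ_j(y) ≤ ς` on the canonical boxes;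
the shift family is any `λ` with `‖λ_j(y)‖ ≤ ‖log ĝ_j(y)⁻¹‖`; conclusion `LocalGaugeSplitOn (π '' □) η_{K−n} t (t₁ + (t₂ + t_∂) + t₃) U` for every `t_∂ > 2CB₃·(4ς)`.
[cite: Balaban1985Variational, (144) p.300, (150)–(152) p.301, (157)–(159) pp.302–303, (161) p.303, (164)–(165) p.304, (168) p.304; Balaban1985RegularSpaces, (1.131) pp.98–99; Balaban1984PropagatorsII, (2.1)–(2.4) p.224, (2.35) p.228, (2.60) p.234, Cor. 2.8 (2.150)–(2.151) p.249; Balaban1984PropagatorsI, (1.18)–(1.20) p.20; Balaban1985Averaging, (8) p.19, (85)–(88) p.31] -/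
theorem localGaugeSplitOn_of_gauge152_recordShearVariation_dominated_cubeDomains_box (F : T4Family) (N : ℕ) [NeZero N] :
    ∃ (Mh₀ R₀ : ℕ) (C δ₀ δ₁ B₃ : ℝ), 0 ≤ C ∧ 0 < δ₀ ∧ 0 < δ₁ ∧ 0 < B₃ ∧
    ∀ (n K : ℕ) (_ : 1 ≤ K - n) (_ : K - n + 1 ≤ F.m + K) (hk : K - n ≤ (F.P K).m + (F.P K).K)
      {Mh R a' : ℕ} (_ : Mh = F.L ^ a') (_ : Mh₀ ≤ Mh) (_ : R₀ ≤ R) (_ : a' + 3 ≤ F.m + n)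
      {a : Pt (F.P K).d} {M ρ : ℕ}
      (_ : F.L * Mh ∣ ρ) (_ : ∀ i, ((F.L * Mh : ℕ) : ℤ) ∣ a i) (_ : F.L * Mh ∣ M) (_ : F.L * Mh ∣ (F.P K).sitesPerDir (K - n)) (_ : R * (F.L * Mh) ≤ ρ)
      (_ : F.L ≤ ρ) (_ : Set.InjOn (cover (F.P K)) (cube (F.P K).L a M ρ (K - n) 0))
      {HV : (BondIdx (cubeDomains (F.P K) a M ρ (K - n) hk) → MatA N) →ₗ[ℂ] (PBond (F.P K) 0 → MatA N)}
      (_ : ∀ (B : BondIdx (cubeDomains (F.P K) a M ρ (K - n) hk) → MatA N) (b : PBond (F.P K) 0),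
        HV B b = ∑ c, ((flatH (F.P K) (K - n) (cubeDomains (F.P K) a M ρ (K - n) hk) (Pi.single c 1) b : ℝ) : ℂ) • B c)
      -- the CANONICAL level boxes of the tower (four equation binders)
      {lo hi : ℕ → Pt (F.P K).d}
      (_ : lo 0 = fun i => ((F.P K).L : ℤ) * (sqLo (F.P K).L a ρ (K - n) 1 i - 1))
      (_ : hi 0 = fun i => ((F.P K).L : ℤ) * (sqHi (F.P K).L a M ρ (K - n) 1 i + 1) + (((F.P K).L : ℤ) - 1))
      (_ : ∀ j, 1 ≤ j → lo j = sqLo (F.P K).L a ρ (K - n) j - 1) (_ : ∀ j, 1 ≤ j → hi j = sqHi (F.P K).L a M ρ (K - n) j + 1)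
      -- the gauge `u♮` of the (r1)+(r4) row and ONE variation letter on the canonical boxes
      (uL : GaugeTransf (F.P K) 0 (SU N)) {ς : ℝ} (_ : 0 ≤ ς) (_ : ς ≤ 1 / 2)
      (_ : ∀ j ≤ K - n, ∀ y : Site (F.P K) j, y ∈ (castSite '' Set.Icc (lo j) (hi j) : Set (Site (F.P K) j)) →
        dist1 ((toMS uL j (castSite (lo j)))⁻¹ * toMS uL j y) ≤ ς)
      -- the shift family, DOMINATED by the (r1) letter family, and its datum
      (lam : (j : ℕ) → Site (F.P K) j → MatA N)
      (_ : ∀ (j : ℕ) (y : Site (F.P K) j), ‖lam j y‖ ≤ ‖mlog (((((toMS uL j (castSite (lo j)))⁻¹ * toMS uL j y)⁻¹ : SU N)) : MatA N)‖)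
      {X : BondIdx (cubeDomains (F.P K) a M ρ (K - n) hk) → MatA N}
      (_ : ∀ c : BondIdx (cubeDomains (F.P K) a M ρ (K - n) hk),
        X c = LatticeFieldCalculus.grad (((F.P K).L : ℝ) ^ (K - n) / ((F.P K).L : ℝ) ^ (c.1.1 : ℕ)) (lam c.1.1) c.1.2)
      -- S3's gauge of `U` on the window and the (159)-splitting of `A − H_V X`
      {U : GaugeField (F.P K) 0 (SU N)} (u : GaugeTransf (F.P K) 0 (SU N)) {A A₁ A₂ A₃ : PBond (F.P K) 0 → MatA N} {t t₁ t₂ t₃ : ℝ}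
      (_ : ∀ b ∈ (Sect2.regionOfSet (F.P K) (cover (F.P K) '' box (F.P K).L a M (K - n))).bonds,
        gaugeU (fun x => ιSU N (u x)) (fun b' => ιSU N (U b')) b = expI ((F.P K).eta (K - n)) (A b))
      (_ : ∀ b ∈ (Sect2.regionOfSet (F.P K) (cover (F.P K) '' box (F.P K).L a M (K - n))).bonds, ‖A b‖ < t)
      (_ : ∀ q ∈ (Sect2.regionOfSet (F.P K) (cover (F.P K) '' box (F.P K).L a M (K - n))).dpairs,
        ‖grad ((F.P K).eta (K - n)) q.2.1 (fun y => A ⟨y, q.2.2⟩) q.1‖ < t)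
      (_ : ∀ b, A b - HV X b = A₁ b + A₂ b - A₃ b)
      (_ : Letters10On (cover (F.P K) '' box (F.P K).L a M (K - n)) ((F.P K).eta (K - n)) t₁ A₁)
      (_ : Letters10On (cover (F.P K) '' box (F.P K).L a M (K - n)) ((F.P K).eta (K - n)) t₂ A₂)
      (_ : Letters10On (cover (F.P K) '' box (F.P K).L a M (K - n)) ((F.P K).eta (K - n)) t₃ A₃)
      {tD : ℝ} (_ : 2 * C * B₃ * (4 * ς) < tD),
      LocalGaugeSplitOn (cover (F.P K) '' box (F.P K).L a M (K - n)) ((F.P K).eta (K - n)) t (t₁ + (t₂ + tD) + t₃) U := by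
  obtain ⟨Mh₀, R₀, C, δ₀, δ₁, B₃, hC, hδ₀, hδ₁, hB₃, hmain⟩ := localGaugeSplitOn_of_gauge152_recordShearVariation_dominated_adm22_T4 F N
  refine ⟨Mh₀, R₀, C, δ₀, δ₁, B₃, hC, hδ₀, hδ₁, hB₃, ?_⟩
  intro n K hk1 hk' hk Mh R a' hMha hMh hR hsize a M ρ hρ ha hM hper hRρ hLρ hinj HV hHV lo hi hlo0 hhi0 hloj hhij uL ς hς0 hς hvar
    lam hlam X hX U u A A₁ A₂ A₃ t t₁ t₂ t₃ he hA hdA h159 h₁ h₂ h₃ tD htD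
  -- `1 ≤ L·M_h`, `(F.P K).L = F.L`
  have hM₁ : 1 ≤ F.L * Mh := by
    rw [hMha]
    exact Nat.one_le_iff_ne_zero.mpr (Nat.mul_ne_zero (by have := F.hL11; omega) (pow_ne_zero _ (by have := F.hL11; omega)))
  have hLP : (F.P K).L = F.L := rfl
  -- the family, its admissibility (39b), the canonical level weights, the window over `Ω_k` (39b)
  have hAdm : Adm22 (cubeDomains (F.P K) a M ρ (K - n) hk) R (F.L * Mh) :=
    adm22_cubeDomains (P := F.P K) hM₁ hρ (by simpa [hLP] using ha) hM hper hRρ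
  have hw : IsLevWeight (F.P K) (K - n) (cubeDomains (F.P K) a M ρ (K - n) hk)
      (fun m b => (((F.P K).L : ℝ) ^ levOf (fun j => {x : Site (F.P K) 0 | (cubeDomains (F.P K) a M ρ (K - n) hk).InOm j x}) (K - n) b.src *
        (((F.P K).L : ℝ)⁻¹) ^ (K - n)) ^ m) := fun _ _ => rfl
  have hY : ∀ x ∈ cover (F.P K) '' box (F.P K).L a M (K - n), (cubeDomains (F.P K) a M ρ (K - n) hk).InOm (K - n) x := by
    rintro _ ⟨x, hx, rfl⟩
    exact inOm_top_cubeDomains_of_mem_box hinj hk1 hx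
  -- the three box-membership facts of the canonical boxes (dag-n07-w4 FILE 1)
  obtain ⟨hboxO, hboxS, hbox0⟩ := levelBoxes_cubeDomains (P := F.P K) (a := a) (M := M) (hk := hk) (by simpa [hLP] using hLρ) hlo0 hhi0 hloj hhij
  exact hmain n K hk1 hk' hMha hMh hR hsize (cubeDomains (F.P K) a M ρ (K - n) hk) rfl hAdm _ hw hY hHV uL lo hi hς0 hς hvar
    hboxO hboxS hbox0 lam hlam hX u he hA hdA h159 h₁ h₂ h₃ htD

open scoped Classical in
/-- ★★ **THE (r1) ORIENTATION AT THE HEAD's FAMILY AND WINDOW, variation-keyed**: the same door for the family `λ_j(y) = −log ĝ_j(y)⁻¹` (dag-n07-w6's composed row (r1)+(r4)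
in potential units; `‖−Z‖ = ‖Z‖`). [cite: Balaban1985Variational, (152) p.301, (157)–(159) pp.302–303, (164)–(165) p.304, (168) p.304; Balaban1985Averaging, (85)–(88) p.31; Balaban1984PropagatorsII, (2.1)–(2.4) p.224, Cor. 2.8 (2.150)–(2.151) p.249] -/
theorem localGaugeSplitOn_of_gauge152_recordShearVariation_neg_cubeDomains_box (F : T4Family) (N : ℕ) [NeZero N] :
    ∃ (Mh₀ R₀ : ℕ) (C δ₀ δ₁ B₃ : ℝ), 0 ≤ C ∧ 0 < δ₀ ∧ 0 < δ₁ ∧ 0 < B₃ ∧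
    ∀ (n K : ℕ) (_ : 1 ≤ K - n) (_ : K - n + 1 ≤ F.m + K) (hk : K - n ≤ (F.P K).m + (F.P K).K)
      {Mh R a' : ℕ} (_ : Mh = F.L ^ a') (_ : Mh₀ ≤ Mh) (_ : R₀ ≤ R) (_ : a' + 3 ≤ F.m + n)
      {a : Pt (F.P K).d} {M ρ : ℕ}
      (_ : F.L * Mh ∣ ρ) (_ : ∀ i, ((F.L * Mh : ℕ) : ℤ) ∣ a i) (_ : F.L * Mh ∣ M) (_ : F.L * Mh ∣ (F.P K).sitesPerDir (K - n)) (_ : R * (F.L * Mh) ≤ ρ)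
      (_ : F.L ≤ ρ) (_ : Set.InjOn (cover (F.P K)) (cube (F.P K).L a M ρ (K - n) 0))
      {HV : (BondIdx (cubeDomains (F.P K) a M ρ (K - n) hk) → MatA N) →ₗ[ℂ] (PBond (F.P K) 0 → MatA N)}
      (_ : ∀ (B : BondIdx (cubeDomains (F.P K) a M ρ (K - n) hk) → MatA N) (b : PBond (F.P K) 0),
        HV B b = ∑ c, ((flatH (F.P K) (K - n) (cubeDomains (F.P K) a M ρ (K - n) hk) (Pi.single c 1) b : ℝ) : ℂ) • B c)
      {lo hi : ℕ → Pt (F.P K).d}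
      (_ : lo 0 = fun i => ((F.P K).L : ℤ) * (sqLo (F.P K).L a ρ (K - n) 1 i - 1))
      (_ : hi 0 = fun i => ((F.P K).L : ℤ) * (sqHi (F.P K).L a M ρ (K - n) 1 i + 1) + (((F.P K).L : ℤ) - 1))
      (_ : ∀ j, 1 ≤ j → lo j = sqLo (F.P K).L a ρ (K - n) j - 1) (_ : ∀ j, 1 ≤ j → hi j = sqHi (F.P K).L a M ρ (K - n) j + 1)
      (uL : GaugeTransf (F.P K) 0 (SU N)) {ς : ℝ} (_ : 0 ≤ ς) (_ : ς ≤ 1 / 2)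
      (_ : ∀ j ≤ K - n, ∀ y : Site (F.P K) j, y ∈ (castSite '' Set.Icc (lo j) (hi j) : Set (Site (F.P K) j)) →
        dist1 ((toMS uL j (castSite (lo j)))⁻¹ * toMS uL j y) ≤ ς)
      (lam : (j : ℕ) → Site (F.P K) j → MatA N)
      (_ : ∀ (j : ℕ) (y : Site (F.P K) j), lam j y = -mlog (((((toMS uL j (castSite (lo j)))⁻¹ * toMS uL j y)⁻¹ : SU N)) : MatA N))
      {X : BondIdx (cubeDomains (F.P K) a M ρ (K - n) hk) → MatA N}
      (_ : ∀ c : BondIdx (cubeDomains (F.P K) a M ρ (K - n) hk),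
        X c = LatticeFieldCalculus.grad (((F.P K).L : ℝ) ^ (K - n) / ((F.P K).L : ℝ) ^ (c.1.1 : ℕ)) (lam c.1.1) c.1.2)
      {U : GaugeField (F.P K) 0 (SU N)} (u : GaugeTransf (F.P K) 0 (SU N)) {A A₁ A₂ A₃ : PBond (F.P K) 0 → MatA N} {t t₁ t₂ t₃ : ℝ}
      (_ : ∀ b ∈ (Sect2.regionOfSet (F.P K) (cover (F.P K) '' box (F.P K).L a M (K - n))).bonds,
        gaugeU (fun x => ιSU N (u x)) (fun b' => ιSU N (U b')) b = expI ((F.P K).eta (K - n)) (A b))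
      (_ : ∀ b ∈ (Sect2.regionOfSet (F.P K) (cover (F.P K) '' box (F.P K).L a M (K - n))).bonds, ‖A b‖ < t)
      (_ : ∀ q ∈ (Sect2.regionOfSet (F.P K) (cover (F.P K) '' box (F.P K).L a M (K - n))).dpairs,
        ‖grad ((F.P K).eta (K - n)) q.2.1 (fun y => A ⟨y, q.2.2⟩) q.1‖ < t)
      (_ : ∀ b, A b - HV X b = A₁ b + A₂ b - A₃ b)
      (_ : Letters10On (cover (F.P K) '' box (F.P K).L a M (K - n)) ((F.P K).eta (K - n)) t₁ A₁)
      (_ : Letters10On (cover (F.P K) '' box (F.P K).L a M (K - n)) ((F.P K).eta (K - n)) t₂ A₂)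
      (_ : Letters10On (cover (F.P K) '' box (F.P K).L a M (K - n)) ((F.P K).eta (K - n)) t₃ A₃)
      {tD : ℝ} (_ : 2 * C * B₃ * (4 * ς) < tD),
      LocalGaugeSplitOn (cover (F.P K) '' box (F.P K).L a M (K - n)) ((F.P K).eta (K - n)) t (t₁ + (t₂ + tD) + t₃) U := by
  obtain ⟨Mh₀, R₀, C, δ₀, δ₁, B₃, hC, hδ₀, hδ₁, hB₃, hmain⟩ := localGaugeSplitOn_of_gauge152_recordShearVariation_dominated_cubeDomains_box F N
  refine ⟨Mh₀, R₀, C, δ₀, δ₁, B₃, hC, hδ₀, hδ₁, hB₃, ?_⟩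
  intro n K hk1 hk' hk Mh R a' hMha hMh hR hsize a M ρ hρ ha hM hper hRρ hLρ hinj HV hHV lo hi hlo0 hhi0 hloj hhij uL ς hς0 hς hvar
    lam hlam X hX U u A A₁ A₂ A₃ t t₁ t₂ t₃ he hA hdA h159 h₁ h₂ h₃ tD htD
  exact hmain n K hk1 hk' hk hMha hMh hR hsize hρ ha hM hper hRρ hLρ hinj hHV hlo0 hhi0 hloj hhij uL hς0 hς hvar lam
    (fun j y => by rw [hlam j y, norm_neg]) hX u he hA hdA h159 h₁ h₂ h₃ htD

open scoped Classical in
/-- ★★ **THE FINE FORM AT THE HEAD's FAMILY AND WINDOW**: the same door with the variation letter on a fine site set `S ⊆ T_η` —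
`hvarU : ∀ x x′ ∈ S, dist1 (u♮(x)⁻¹·u♮(x′)) ≤ ς` — and `hS : ∀ j ≤ K − n, ∀ y ∈ castSite '' [lo_j, hi_j], embIter j y ∈ S` (DISPLAYED: the representatives of the canonical
boxes lie in `S`; for `S :=` the fine collar cube this is the cube family's margin arithmetic).  The shape the data lane's supplier proves (per-fine-bond letters by the coarsest
crossed face summed along the corner staircase, FILE 9 §1 + `N07FinePathCrossingCount`). [cite: Balaban1985Variational, (144) p.300, (150)–(152) p.301, (157)–(159) pp.302–303, (164)–(165) p.304, (168) p.304; Balaban1985Averaging, (8) p.19, (85)–(88) p.31; Balaban1984PropagatorsII, (2.1)–(2.4) p.224, Cor. 2.8 (2.150)–(2.151) p.249; Balaban1984PropagatorsI, (1.18)–(1.20) p.20] -/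
theorem localGaugeSplitOn_of_gauge152_recordShearFineVariation_dominated_cubeDomains_box (F : T4Family) (N : ℕ) [NeZero N] :
    ∃ (Mh₀ R₀ : ℕ) (C δ₀ δ₁ B₃ : ℝ), 0 ≤ C ∧ 0 < δ₀ ∧ 0 < δ₁ ∧ 0 < B₃ ∧
    ∀ (n K : ℕ) (_ : 1 ≤ K - n) (_ : K - n + 1 ≤ F.m + K) (hk : K - n ≤ (F.P K).m + (F.P K).K)
      {Mh R a' : ℕ} (_ : Mh = F.L ^ a') (_ : Mh₀ ≤ Mh) (_ : R₀ ≤ R) (_ : a' + 3 ≤ F.m + n)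
      {a : Pt (F.P K).d} {M ρ : ℕ}
      (_ : F.L * Mh ∣ ρ) (_ : ∀ i, ((F.L * Mh : ℕ) : ℤ) ∣ a i) (_ : F.L * Mh ∣ M) (_ : F.L * Mh ∣ (F.P K).sitesPerDir (K - n)) (_ : R * (F.L * Mh) ≤ ρ)
      (_ : F.L ≤ ρ) (_ : Set.InjOn (cover (F.P K)) (cube (F.P K).L a M ρ (K - n) 0))
      {HV : (BondIdx (cubeDomains (F.P K) a M ρ (K - n) hk) → MatA N) →ₗ[ℂ] (PBond (F.P K) 0 → MatA N)}
      (_ : ∀ (B : BondIdx (cubeDomains (F.P K) a M ρ (K - n) hk) → MatA N) (b : PBond (F.P K) 0),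
        HV B b = ∑ c, ((flatH (F.P K) (K - n) (cubeDomains (F.P K) a M ρ (K - n) hk) (Pi.single c 1) b : ℝ) : ℂ) • B c)
      {lo hi : ℕ → Pt (F.P K).d}
      (_ : lo 0 = fun i => ((F.P K).L : ℤ) * (sqLo (F.P K).L a ρ (K - n) 1 i - 1))
      (_ : hi 0 = fun i => ((F.P K).L : ℤ) * (sqHi (F.P K).L a M ρ (K - n) 1 i + 1) + (((F.P K).L : ℤ) - 1))
      (_ : ∀ j, 1 ≤ j → lo j = sqLo (F.P K).L a ρ (K - n) j - 1) (_ : ∀ j, 1 ≤ j → hi j = sqHi (F.P K).L a M ρ (K - n) j + 1)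
      -- the gauge `u♮`, ONE variation letter on a fine site set `S`, the canonical boxes' representatives in `S`
      (uL : GaugeTransf (F.P K) 0 (SU N)) {S : Set (Site (F.P K) 0)} {ς : ℝ} (_ : 0 ≤ ς) (_ : ς ≤ 1 / 2)
      (_ : ∀ x ∈ S, ∀ x' ∈ S, dist1 ((uL x)⁻¹ * uL x') ≤ ς)
      (_ : ∀ j ≤ K - n, ∀ y : Site (F.P K) j, y ∈ (castSite '' Set.Icc (lo j) (hi j) : Set (Site (F.P K) j)) → embIter j y ∈ S)
      (lam : (j : ℕ) → Site (F.P K) j → MatA N)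
      (_ : ∀ (j : ℕ) (y : Site (F.P K) j), ‖lam j y‖ ≤ ‖mlog (((((toMS uL j (castSite (lo j)))⁻¹ * toMS uL j y)⁻¹ : SU N)) : MatA N)‖)
      {X : BondIdx (cubeDomains (F.P K) a M ρ (K - n) hk) → MatA N}
      (_ : ∀ c : BondIdx (cubeDomains (F.P K) a M ρ (K - n) hk),
        X c = LatticeFieldCalculus.grad (((F.P K).L : ℝ) ^ (K - n) / ((F.P K).L : ℝ) ^ (c.1.1 : ℕ)) (lam c.1.1) c.1.2)
      {U : GaugeField (F.P K) 0 (SU N)} (u : GaugeTransf (F.P K) 0 (SU N)) {A A₁ A₂ A₃ : PBond (F.P K) 0 → MatA N} {t t₁ t₂ t₃ : ℝ}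
      (_ : ∀ b ∈ (Sect2.regionOfSet (F.P K) (cover (F.P K) '' box (F.P K).L a M (K - n))).bonds,
        gaugeU (fun x => ιSU N (u x)) (fun b' => ιSU N (U b')) b = expI ((F.P K).eta (K - n)) (A b))
      (_ : ∀ b ∈ (Sect2.regionOfSet (F.P K) (cover (F.P K) '' box (F.P K).L a M (K - n))).bonds, ‖A b‖ < t)
      (_ : ∀ q ∈ (Sect2.regionOfSet (F.P K) (cover (F.P K) '' box (F.P K).L a M (K - n))).dpairs,
        ‖grad ((F.P K).eta (K - n)) q.2.1 (fun y => A ⟨y, q.2.2⟩) q.1‖ < t)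
      (_ : ∀ b, A b - HV X b = A₁ b + A₂ b - A₃ b)
      (_ : Letters10On (cover (F.P K) '' box (F.P K).L a M (K - n)) ((F.P K).eta (K - n)) t₁ A₁)
      (_ : Letters10On (cover (F.P K) '' box (F.P K).L a M (K - n)) ((F.P K).eta (K - n)) t₂ A₂)
      (_ : Letters10On (cover (F.P K) '' box (F.P K).L a M (K - n)) ((F.P K).eta (K - n)) t₃ A₃)
      {tD : ℝ} (_ : 2 * C * B₃ * (4 * ς) < tD),
      LocalGaugeSplitOn (cover (F.P K) '' box (F.P K).L a M (K - n)) ((F.P K).eta (K - n)) t (t₁ + (t₂ + tD) + t₃) U := by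
  obtain ⟨Mh₀, R₀, C, δ₀, δ₁, B₃, hC, hδ₀, hδ₁, hB₃, hmain⟩ := localGaugeSplitOn_of_gauge152_recordShearVariation_dominated_cubeDomains_box F N
  refine ⟨Mh₀, R₀, C, δ₀, δ₁, B₃, hC, hδ₀, hδ₁, hB₃, ?_⟩
  intro n K hk1 hk' hk Mh R a' hMha hMh hR hsize a M ρ hρ ha hM hper hRρ hLρ hinj HV hHV lo hi hlo0 hhi0 hloj hhij uL S ς hς0 hς hvarU hS
    lam hlam X hX U u A A₁ A₂ A₃ t t₁ t₂ t₃ he hA hdA h159 h₁ h₂ h₃ tD htD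
  -- the box corner is a box site as soon as the box meets a site, so its representative lies in `S` too
  have hvar : ∀ j ≤ K - n, ∀ y : Site (F.P K) j, y ∈ (castSite '' Set.Icc (lo j) (hi j) : Set (Site (F.P K) j)) →
      dist1 ((toMS uL j (castSite (lo j)))⁻¹ * toMS uL j y) ≤ ς := by
    intro j hj y hy
    have hlo : (castSite (lo j) : Site (F.P K) j) ∈ (castSite '' Set.Icc (lo j) (hi j) : Set (Site (F.P K) j)) := by
      obtain ⟨z, hz, -⟩ := hy
      exact ⟨lo j, ⟨le_rfl, hz.1.trans hz.2⟩, rfl⟩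
    exact dist1_centredShear_le_of_fineVariation uL hvarU (hS j hj _ hlo) (hS j hj y hy)
  exact hmain n K hk1 hk' hk hMha hMh hR hsize hρ ha hM hper hRρ hLρ hinj hHV hlo0 hhi0 hloj hhij uL hς0 hς hvar lam hlam hX u he hA hdA h159 h₁ h₂ h₃ htD

end Summit.QuantumFields.YangMills.BalabanUVNodes.N07SplitClauseRecordShearVariationAtCubeDomains

end
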